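import Summits.CriticalPhenomena.PercolationContinuityZ3.Theorems.PercNearOneGluingAdditiveGluingOneBond
import HarnessLib

/-!
# Crux `PercNearOneGluing.AdditiveGluing` (stmt-CriticalPhenomena-4576), line `tieline`: the one-edge identity for the
# fixed-relay ML5 slack (registered stub `stub_ml5EdgeIdentity_c9`)

Support file (`--supports stmt-CriticalPhenomena-4576`, lead c9, skeleton v18).  No definitions, no named facts, no sorries.

Weighted graph on `Fin n` (`μ_w = prodBernoulli w`), relays `u, v` (the pair `A = {u, v}` to be glued), spectator `c`,
observer `o`, target `b`.  With `N = {c ↮ u} ∩ {c ↮ v}`, `O_A = {o ↔ u} ∪ {o ↔ v}`,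
`G_x = μ({x ↮ b} ∩ ({x ↔ u} ∪ {x ↔ v}) ∩ ({u ↔ b} ∪ {v ↔ b}))` (`x = o, c`), `G_u = μ({u ↮ b} ∩ {v ↔ b})`,
the ML5 slack for the fixed relay `u` is `s_u(w) = α·(G_u − G_o) + γ·(G_c − G_o)`, `α = μ(N ∩ O_A)`, `γ = μ(N ∩ O_Aᶜ)`.

**`stub_ml5EdgeIdentity_c9`.**  For any non-diagonal pair `e`, with `w⁰ = w[e ↦ 0]`, `w¹ = w[e ↦ 1]`, `t = w(e)`,
`Pⁱ = μ_{wⁱ}(N)`, `δ = α⁰P¹ − α¹P⁰`, `Λⁱ = (G_u − G_c)(wⁱ)`: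
`P⁰P¹·s_u(w) = ((1−t)P⁰ + tP¹)·((1−t)P¹·s_u(w⁰) + t·P⁰·s_u(w¹)) + t(1−t)·δ·(P⁰Λ¹ − P¹Λ⁰)`.

Proof.  Every probability `μ_w(S)` is affine in the weight of the single pair `e`
(`stub_oneBondDecomp_k15`: `μ_w(S) = (1 − t)·μ_{w⁰}(S) + t·μ_{w¹}(S)`), so `s_u(w)` is a sum of products of two affine
functions of `t`; together with `Pⁱ = αⁱ + γⁱ` (`μ(N) = μ(N ∩ O_A) + μ(N ∩ O_Aᶜ)`) the claim is a polynomial identity in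
the endpoint values (`ML5EdgeIdentity.alg`, closed by `ring`).  The hypothesis `¬ e.IsDiag` is not used.
[cite: KozmaNitzan2024, proof of Thm. 4 (pp. 13–14): modifying the weight of one edge at a time]
-/

namespace Summit.CriticalPhenomena.PercolationContinuityZ3.Theorems

open MeasureTheory Set
open Literature.Probability.LatticeModels (prodBernoulli)
open Literature.Probability.Percolation (BondConfig openConn)

noncomputable section
open Classical

namespace ML5EdgeIdentity

/-- The polynomial identity behind `stub_ml5EdgeIdentity_c9`: endpoint values `a = α`, `g = γ`, `U = G_u`, `O = G_o`,
`C = G_c` at `w⁰` (index `₀`) and `w¹` (index `₁`), `Pⁱ = aᵢ + gᵢ`, every quantity at `w` equal to `(1 − t)·x₀ + t·x₁`.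
[folklore] -/
theorem alg (t a₀ a₁ g₀ g₁ U₀ U₁ O₀ O₁ C₀ C₁ : ℝ) :
    (a₀ + g₀) * (a₁ + g₁) *
        (((1 - t) * a₀ + t * a₁) * (((1 - t) * U₀ + t * U₁) - ((1 - t) * O₀ + t * O₁)) +
          ((1 - t) * g₀ + t * g₁) * (((1 - t) * C₀ + t * C₁) - ((1 - t) * O₀ + t * O₁))) =
      ((1 - t) * (a₀ + g₀) + t * (a₁ + g₁)) *
          ((1 - t) * (a₁ + g₁) * (a₀ * (U₀ - O₀) + g₀ * (C₀ - O₀)) +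
            t * (a₀ + g₀) * (a₁ * (U₁ - O₁) + g₁ * (C₁ - O₁))) +
        t * (1 - t) * (a₀ * (a₁ + g₁) - a₁ * (a₀ + g₀)) *
          ((a₀ + g₀) * (U₁ - C₁) - (a₁ + g₁) * (U₀ - C₀)) := by
  ring

/-- `μ(N) = μ(N ∩ O) + μ(N ∩ Oᶜ)` for the percolation measure of a finite weighted graph. [folklore] -/
theorem real_eq_inter_add_inter_compl {n : ℕ} (w : Sym2 (Fin n) → unitInterval)
    (N O : Set (BondConfig (Fin n))) :
    (prodBernoulli w).real N = (prodBernoulli w).real (N ∩ O) + (prodBernoulli w).real (N ∩ Oᶜ) := by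
  rw [← Set.sdiff_eq, measureReal_inter_add_sdiff (Set.toFinite _).measurableSet]

end ML5EdgeIdentity

/-- **Registered stub `stub_ml5EdgeIdentity_c9`** (line `tieline`, crux `AdditiveGluing`): the one-edge identity for the
fixed-relay ML5 slack `s_u(w) = α·(G_u − G_o) + γ·(G_c − G_o)`, `α = μ(N ∩ O_A)`, `γ = μ(N ∩ O_Aᶜ)`:
with `w⁰ = w[e↦0]`, `w¹ = w[e↦1]`, `t = w(e)`, `Pⁱ = μ_{wⁱ}(N)`, `δ = α⁰P¹ − α¹P⁰`, `Λⁱ = (G_u − G_c)(wⁱ)`,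
`P⁰P¹·s_u(w) = ((1−t)P⁰ + tP¹)·((1−t)P¹s_u(w⁰) + tP⁰s_u(w¹)) + t(1−t)·δ·(P⁰Λ¹ − P¹Λ⁰)`.
Pure algebra from the one-bond decomposition `stub_oneBondDecomp_k15` and `Pⁱ = αⁱ + γⁱ` (`ML5EdgeIdentity.alg`).
[cite: KozmaNitzan2024, proof of Thm. 4 (pp. 13–14)] -/
theorem stub_ml5EdgeIdentity_c9 : ∀ (n : ℕ) (w : Sym2 (Fin n) → unitInterval) (o b u v c : Fin n) (e : Sym2 (Fin n)), ¬ e.IsDiag →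
    let μ := fun (w' : Sym2 (Fin n) → unitInterval) (S : Set (Literature.Probability.Percolation.BondConfig (Fin n))) => (Literature.Probability.LatticeModels.prodBernoulli w').real S
    let N : Set (Literature.Probability.Percolation.BondConfig (Fin n)) := (Literature.Probability.Percolation.openConn c u)ᶜ ∩ (Literature.Probability.Percolation.openConn c v)ᶜ
    let OA : Set (Literature.Probability.Percolation.BondConfig (Fin n)) := Literature.Probability.Percolation.openConn o u ∪ Literature.Probability.Percolation.openConn o v
    let Go : Set (Literature.Probability.Percolation.BondConfig (Fin n)) := (Literature.Probability.Percolation.openConn o b)ᶜ ∩ (Literature.Probability.Percolation.openConn o u ∪ Literature.Probability.Percolation.openConn o v) ∩ (Literature.Probability.Percolation.openConn u b ∪ Literature.Probability.Percolation.openConn v b)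
    let Gc : Set (Literature.Probability.Percolation.BondConfig (Fin n)) := (Literature.Probability.Percolation.openConn c b)ᶜ ∩ (Literature.Probability.Percolation.openConn c u ∪ Literature.Probability.Percolation.openConn c v) ∩ (Literature.Probability.Percolation.openConn u b ∪ Literature.Probability.Percolation.openConn v b)
    let Gu : Set (Literature.Probability.Percolation.BondConfig (Fin n)) := (Literature.Probability.Percolation.openConn u b)ᶜ ∩ Literature.Probability.Percolation.openConn v b
    let s := fun (w' : Sym2 (Fin n) → unitInterval) => μ w' (N ∩ OA) * (μ w' Gu - μ w' Go) + μ w' (N ∩ OAᶜ) * (μ w' Gc - μ w' Go)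
    let w0 := Function.update w e 0
    let w1 := Function.update w e 1
    let t : ℝ := (w e : ℝ)
    μ w0 N * μ w1 N * s w =
      ((1 - t) * μ w0 N + t * μ w1 N) * ((1 - t) * μ w1 N * s w0 + t * μ w0 N * s w1) +
        t * (1 - t) * (μ w0 (N ∩ OA) * μ w1 N - μ w1 (N ∩ OA) * μ w0 N) *
          (μ w0 N * (μ w1 Gu - μ w1 Gc) - μ w1 N * (μ w0 Gu - μ w0 Gc)) := by
  intro n w o b u v c e _ μ N OA Go Gc Gu s w0 w1 t
  -- `Pⁱ = αⁱ + γⁱ`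
  have hP0 : μ w0 N = μ w0 (N ∩ OA) + μ w0 (N ∩ OAᶜ) := ML5EdgeIdentity.real_eq_inter_add_inter_compl w0 N OA
  have hP1 : μ w1 N = μ w1 (N ∩ OA) + μ w1 (N ∩ OAᶜ) := ML5EdgeIdentity.real_eq_inter_add_inter_compl w1 N OA
  -- one-bond decomposition of every probability at `w`
  have d : ∀ S : Set (BondConfig (Fin n)), μ w S = (1 - t) * μ w0 S + t * μ w1 S :=
    fun S => stub_oneBondDecomp_k15 n w e S
  have key := ML5EdgeIdentity.alg t (μ w0 (N ∩ OA)) (μ w1 (N ∩ OA)) (μ w0 (N ∩ OAᶜ)) (μ w1 (N ∩ OAᶜ))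
    (μ w0 Gu) (μ w1 Gu) (μ w0 Go) (μ w1 Go) (μ w0 Gc) (μ w1 Gc)
  rw [← hP0, ← hP1, ← d, ← d, ← d, ← d, ← d] at key
  exact key

end

end Summit.CriticalPhenomena.PercolationContinuityZ3.Theorems
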